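import Literature.MathematicalPhysics.QuantumFieldTheory.Balaban1983to89.B8Prop7AdmittedFamilyRec
import Literature.MathematicalPhysics.QuantumFieldTheory.Balaban1983to89.B7Eq167GeneralRec
import Literature.MathematicalPhysics.QuantumFieldTheory.Balaban1983to89.B8Ineq130Rec
import Literature.MathematicalPhysics.QuantumFieldTheory.Balaban1983to89.B8Eq1112Local

/-!
# `Balaban1983to89.B8Eq1112LocalRec` — RECORD TWIN of `B8Eq1112Local` §2 (first half): ONE GLOBAL EXTENSION of a tower gauge fixing ([Balaban1985RegularSpaces] proof of Theorem 4,
# (1.112) p. 95 via [Balaban1985Averaging] Proposition 8 — the device «gauge fixing of the clamped pair is unitary-valued and lies in `Λ_j`») FOR THE SYMMETRISED CENTRED block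
# averaging (0.4) of [Balaban1987RG1], with the RECORD's Prop-4 regime

statement-level skeleton of published theorems with citation tags; proofs where landed; nothing here is a claim about the Yang–Mills mass gap

T. Bałaban, *Spaces of regular gauge field configurations on a lattice and gauge fixing conditions*, Commun. Math. Phys. **99** (1985) 75–102 `[Balaban1985RegularSpaces]`
("[6]"): (1.112) p. 95, p. 88 (sentence after (1.69)); T. Bałaban, *Averaging operations for lattice gauge theories*, Commun. Math. Phys. **98** (1985) 17–51
`[Balaban1985Averaging]` ("[3]"): (104)–(106) p. 33, (166)–(167) p. 44, Proposition 8 p. 45; T. Bałaban, *Renormalization group approach to lattice gauge field theories. I*,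
Commun. Math. Phys. **109** (1987) 249–301 `[Balaban1987RG1]` ("[I]"): (0.3)–(0.4) pp. 252–253.  STATUS: published.

CITATION HEADER (lean-in-tree rule).  Cell `pub-ymgap`, «N05-REC» stage 2 (director-ym №254∕№255∕№288), item R5-γ (Sect. E ∕ Prop 5 join for the record; dag-n05-c's remainder
list, HANDOFF g26) — typed by the LEAD PEN dag-n05-e g38 (inventory `N05-REC-INVENTORY.md` §R5 row `B8Eq1112Local`: class A = `glev_clamp_unitary_inLambda`).  WHAT IS REPRODUCED
= ✓ that theorem under the token map, over `B8Prop7AdmittedFamilyRec.glevZ_mem_unitaryUnits` and `B7Eq167GeneralRec.inLambdaZ_glevZ_general` (record constant `20dKZ·c` for the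
engine's `40d·c`, smallness `1024·d·KZ·c ≤ 1`); the engine's §2 second half ∕ §3 ∕ §4 are not on the crown's kernel cone and are not twinned.  TOKEN MAP: `glev ∕ avgIter ∕ InLambda
↦ glevZ ∕ avgIterZ ∕ InLambdaZ`; the tower `B8Ineq130.tlo ∕ thi ↦ B8Ineq130Rec.tlo ∕ thi` (CENTRED); regime `(hL : 2 ≤ L) ↦ (hLs : L = 2s+1) (hs : 1 ≤ s)`, `C0 ↦ C0Z`, windows
as in `B8Prop7AdmittedFamilyRec`.  Declaration name = engine name with the object token `Z` (T5).  Kind «kernel-checked proof», theorems only; no `def`, no `instance`, no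
`notation`, no existing module modified.  `--supports stmt-QuantumFields-20541` (K0⁷-keyed, COUNT-NEUTRAL).

HONEST SCOPE: by-name composition of record lemmas + clamp bookkeeping; nothing of Bałaban's analysis re-proved; `HThm4Rec` UNDISCHARGED; caveat (C-S3-1) + addendum v4 stand; N05
[B8] DISCHARGED OF RECORD untouched; N05 ∕ N07 NOT discharged; COUNT of record unmoved · K numerically unchanged; one finite `𝕋⁴` programme at fixed `ε`, Bałaban AS PRINTED;
nothing continuum ∕ ℝ⁴ ∕ OS ∕ mass-gap ∕ Clay.  No `sorry`, no `def`.

[cite: Balaban1985RegularSpaces, (1.112) p.95, p.88; Balaban1985Averaging, (104)–(106) p.33, (166)–(167) p.44, Proposition 8 p.45; Balaban1987RG1, (0.3)–(0.4) pp.252–253]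
-/

noncomputable section

open NormedSpace

namespace Literature.MathematicalPhysics.QuantumFieldTheory.Balaban1983to89.B8Eq1112LocalRec

open B7Prop1Explicit B7Prop2Explicit B7Prop3Flat B7Prop1Local MatrixLog
open B7Prop2Rec (AvgClosedZ C0Z avgClosedZ_unitaryUnits)
open B7Prop4GeneralLevelsRec (cZ gZ KZ gZ_nonneg)
open BlockAveragingZd (avgIterZ)
open B7SectCDGaugeAveragesRec (glevZ)
open B7SectEFLinearisationRec (InLambdaZ)
open B7Eq167GeneralRec (inLambdaZ_glevZ_general)
open B8Ineq130Rec (tlo thi tlo_le_thi)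
open B8Prop7AdmittedFamilyRec (glevZ_mem_unitaryUnits)

-- `Site` alone could resolve to the torus sites of `Setup.lean`; re-export the `ℤ^d` sites of `B7Prop1Explicit`.
export B7Prop1Explicit (Site)

variable {d : ℕ}

/-! ## §1 Device: the clamp is multiplicative; the clamped exponential field -/

section Device

variable {G : Type*} [Group G] {lo hi : Site d}

/-- `π^*(VW) = π^*V · π^*W` (the clamp `B7Prop1Local.clampCfg` is a pointwise operation). [folklore] -/
private theorem clampCfg_mul (V W : Site d → Fin d → G) : clampCfg lo hi (V * W) = clampCfg lo hi V * clampCfg lo hi W := by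
  funext x κ
  simp only [clampCfg, Pi.mul_apply]
  split_ifs <;> simp

end Device

section Main

variable {𝔸 : Type*} [CStarAlgebra 𝔸] [Nontrivial 𝔸]
variable {L s : ℕ} {j : ℕ} {y : Site d} {U₀ : Site d → Fin d → 𝔸ˣ} {α₀ αP c : ℝ} {B : Site d → Fin d → 𝔸}

omit [Nontrivial 𝔸] in
/-- `π^*(e^{B}) = e^{B^π}` for the clamped exponent `B^π(x, κ) = B(πx, κ)` on the clamp's bonds, `0` elsewhere. [folklore] -/
private theorem clampCfg_expCfg (lo hi : Site d) (B : Site d → Fin d → 𝔸) :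
    clampCfg lo hi (expCfg B) = expCfg (fun x κ => if lo κ ≤ x κ ∧ x κ < hi κ then B (clamp lo hi x) κ else 0) := by
  funext x κ
  simp only [clampCfg, expCfg]
  split_ifs
  · rfl
  · exact (B7Prop8Flat.expUnit_zero (𝔸 := 𝔸)).symm

omit [Nontrivial 𝔸] in
/-- The clamped exponent inherits the box bound: `‖B^π(x, κ)‖ ≤ b` from `‖B‖ ≤ b` on the bonds of the box (`b ≥ 0`). [folklore] -/
private theorem norm_clampB_le {lo hi : Site d} (hlohi : ∀ i, lo i ≤ hi i) {b : ℝ} (hb : 0 ≤ b)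
    (hB : ∀ (x : Site d) (κ : Fin d), InBox lo hi x → InBox lo hi (x + e κ) → ‖B x κ‖ ≤ b) (x : Site d) (κ : Fin d) :
    ‖(fun x κ => if lo κ ≤ x κ ∧ x κ < hi κ then B (clamp lo hi x) κ else 0) x κ‖ ≤ b := by
  by_cases hP : lo κ ≤ x κ ∧ x κ < hi κ
  · simp only [hP, and_self, if_true]
    have hx := clamp_inBox hlohi x
    have hxe : InBox lo hi (clamp lo hi x + e κ) := by rw [← clamp_add_e_of hP]; exact clamp_inBox hlohi _
    exact hB _ κ hx hxe
  · simp only [hP, if_false, norm_zero]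
    exact hb

/-! ## §2 Proposition 8 of [3] for the global extension of one tower gauge fixing, RECORD averages -/

/-- (RECORD TWIN of `B8Eq1112Local.glev_clamp_unitary_inLambda`.) **ONE GLOBAL EXTENSION** (device): for `U₀` unitary-valued and regular on the CENTRED `Bʲ(y)`, `U₁ = e^{B}`
unitary-valued with `U₁U₀` regular on `Bʲ(y)` and `|B| ≤ cL^{−j}` on `Bʲ(y)`, the record gauge fixing `g = glevZ(π^*U₀, π^*U₁) … j 0` of the clamped pair is unitary-valued
(`B8Prop7AdmittedFamilyRec.glevZ_mem_unitaryUnits`) and lies in `Λ_j(π^*U₀, 20dKZ·c)` (`B7Eq167GeneralRec.inLambdaZ_glevZ_general`); odd `L = 2s+1`, `s ≥ 1`, `d ≥ 1`, record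
windows `e^{4cZ·α₀}(1 + 2C₁KZ²·c) ≤ 2`, `KZ·c ≤ c₃`, `1024·d·KZ·c ≤ 1`.
[cite: Balaban1985RegularSpaces, p.88 (sentence after (1.69)), (1.112) p.95; Balaban1985Averaging, (104)–(106) p.33, (166)–(167) p.44; Balaban1987RG1, (0.3)–(0.4) pp.252–253] -/
theorem glevZ_clamp_unitary_inLambdaZ (hLs : L = 2 * s + 1) (hs : 1 ≤ s) (hd : 1 ≤ d) (hU₀ : ∀ x κ, U₀ x κ ∈ unitaryUnits 𝔸)
    (hα : 0 < α₀) (hα3 : C0Z d * α₀ ≤ 1 / 3) (hα4 : 4 * α₀ ≤ c2' d L)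
    (h33 : pdevOn (tlo L y j) (thi L y j) U₀ < α₀ * (((L : ℝ) ^ j)⁻¹) ^ 2) (hc : 0 ≤ c)
    (hsmall : Real.exp (4 * cZ d * α₀) * (1 + 2 * (131072 * ((d : ℝ) + 1) ^ 2) * (KZ d L) ^ 2 * c) ≤ 2)
    (hc₃ : KZ d L * c ≤ c3 d L) (hsm : 1024 * (d : ℝ) * KZ d L * c ≤ 1)
    (hαP : 0 < αP) (hαP3 : C0Z d * αP ≤ 1 / 3) (hαP2 : 2 * αP ≤ c2' d L) (hL1 : 1 ≤ L)
    (hBu : ∀ (x : Site d) (κ : Fin d), expCfg B x κ ∈ unitaryUnits 𝔸)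
    (h69 : ∀ (x : Site d) (κ : Fin d), InBox (tlo L y j) (thi L y j) x → InBox (tlo L y j) (thi L y j) (x + e κ) →
      ‖B x κ‖ ≤ c * ((L : ℝ) ^ j)⁻¹)
    (hP : pdevOn (tlo L y j) (thi L y j) (expCfg B * U₀) < αP * (((L : ℝ) ^ j)⁻¹) ^ 2) :
    (∀ x, glevZ L hL1 (clampCfg (tlo L y j) (thi L y j) U₀) (clampCfg (tlo L y j) (thi L y j) (expCfg B)) j 0 x ∈ unitaryUnits 𝔸) ∧
      InLambdaZ L (clampCfg (tlo L y j) (thi L y j) U₀)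
        (glevZ L hL1 (clampCfg (tlo L y j) (thi L y j) U₀) (clampCfg (tlo L y j) (thi L y j) (expCfg B)) j 0) j (20 * d * KZ d L * c)
        ((L : ℝ) ^ j)⁻¹ := by
  have hlohi : ∀ i, tlo L y j i ≤ thi L y j i := tlo_le_thi L le_rfl j
  have hG : AvgClosedZ d L (unitaryUnits 𝔸) := avgClosedZ_unitaryUnits d L
  have hUU : ∀ x κ, U₀ x κ ∈ U1 𝔸 := fun x κ => hG.le_U1 (hU₀ x κ)
  have hLr : (1 : ℝ) ≤ L := by exact_mod_cast hL1
  have hLj : (0 : ℝ) < (L : ℝ) ^ j := by positivity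
  have hkey : (L : ℝ) ^ j * (c * ((L : ℝ) ^ j)⁻¹) = c := by field_simp
  have hb : 0 ≤ c * ((L : ℝ) ^ j)⁻¹ := by positivity
  set U₀c := clampCfg (tlo L y j) (thi L y j) U₀ with hU₀c_def
  have hU₀c : ∀ x κ, U₀c x κ ∈ unitaryUnits 𝔸 := clampCfg_mem hU₀
  have h52c : pdev U₀c < α₀ * (((L : ℝ) ^ j)⁻¹) ^ 2 := (pdev_clampCfg_le hlohi hUU).trans_lt h33
  set Bc : Site d → Fin d → 𝔸 := fun x κ => if tlo L y j κ ≤ x κ ∧ x κ < thi L y j κ then B (clamp (tlo L y j) (thi L y j) x) κ else 0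
    with hBc_def
  have hexp : clampCfg (tlo L y j) (thi L y j) (expCfg B) = expCfg Bc := clampCfg_expCfg _ _ B
  have hBc : ∀ x κ, ‖Bc x κ‖ ≤ c * ((L : ℝ) ^ j)⁻¹ := norm_clampB_le hlohi hb h69
  have hBcu : ∀ x κ, expCfg Bc x κ ∈ unitaryUnits 𝔸 := fun x κ => by rw [← hexp]; exact clampCfg_mem hBu x κ
  -- (52) for the clamped product `e^{Bc}·π^*U₀ = π^*(U₁U₀)`
  have hPU : ∀ x κ, (expCfg B * U₀) x κ ∈ U1 𝔸 := fun x κ => by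
    rw [Pi.mul_apply]; exact (U1 𝔸).mul_mem (hG.le_U1 (hBu x κ)) (hUU x κ)
  have hprod : expCfg Bc * U₀c = clampCfg (tlo L y j) (thi L y j) (expCfg B * U₀) := by rw [clampCfg_mul, hexp]
  have hPc : pdev (expCfg Bc * U₀c) < αP * (((L : ℝ) ^ j)⁻¹) ^ 2 := by
    rw [hprod]; exact (pdev_clampCfg_le hlohi hPU).trans_lt hP
  rw [hexp]
  refine ⟨fun x => ?_, ?_⟩
  · exact glevZ_mem_unitaryUnits hLs hs hd hU₀c hBcu hα hα3 hα4 h52c hb hBc (by rw [hkey]; exact hsmall)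
      (by rw [hkey]; exact hc₃) (by rw [hkey]; exact hsm) hαP hαP3 hαP2 hPc hL1 0 (Nat.zero_le _) x
  · have hs64 : 64 * (d : ℝ) * KZ d L * ((L : ℝ) ^ j * (c * ((L : ℝ) ^ j)⁻¹)) ≤ 1 := by
      rw [hkey]
      have hK : 0 ≤ (d : ℝ) * KZ d L * c := by
        have hK0 : 0 ≤ KZ d L := by unfold KZ; have := gZ_nonneg d L; positivity
        positivity
      linarith
    have h := inLambdaZ_glevZ_general hLs hs hd hG hU₀c hα hα3 hα4 h52c hb hBc (by rw [hkey]; exact hsmall) (by rw [hkey]; exact hc₃) hs64 hL1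
    rwa [hkey] at h

end Main

end Literature.MathematicalPhysics.QuantumFieldTheory.Balaban1983to89.B8Eq1112LocalRec

end
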